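import Mathlib
import HarnessLib
import Literature.Computability.AlgebraicComplexity.AsymptoticSpectrum
import Literature.Computability.AlgebraicComplexity.QuantumFunctionals
import Literature.Computability.AlgebraicComplexity.BorderRankCW
import Summits.MatrixMultiplication.MatrixMultiplication.Theorems.OutsiderSandwichMinrankGap

/-!
# OutsiderSandwich — restriction is degeneration (equal formats), and the minrank gap for restrictions
(lens-4 g33, K33-D; companion of `OutsiderSandwichMinrankGap`)

Route-independent support kernel (no `Theses` import, no new definitions).

`TensorDegeneratesTo s t` (orbit-closure degeneration, `QuantumFunctionals`) is stated for tensors of one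
format; `TensorRestrictsTo s t` (`AsymptoticSpectrum`) allows arbitrary linear maps.  The folklore bridge
"restriction ⟹ degeneration" for equal formats was missing from the tree; §1 proves it
(`tensorDegeneratesTo_of_restrictsTo`): if `t = (A ⊗ B ⊗ C)·s` with square `A, B, C`, then
`(A - z•1, B - z•1, C - z•1) ∈ GL³` for all `z` off the (finite) spectra, and `t` is the limit `z → 0`
along the punctured neighbourhood.  Hence every non-degeneration theorem of the lineage
(`OutsiderSandwichNoPerfectDegeneration`, `OutsiderSandwichMinrankGap`) is at once a non-restriction
theorem at finite level for equal formats (§2 of the companion corollary file).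

References: [cite: ChristandlVranaZuiddam2023, Rem. 1.2]; [cite: BurgisserIkenmeyer2017, §4.2];
[cite: Strassen1988, §3].
-/

noncomputable section

open scoped BigOperators Matrix Topology
open Filter

open Literature.Computability.AlgebraicComplexity

namespace Summit.MatrixMultiplication.MatrixMultiplication.Theorems.OutsiderSandwichRestrictionGap

/-! ## §1  Restriction implies degeneration (same format) -/

section General

variable {ι κ μ : Type*} [Fintype ι] [Fintype κ] [Fintype μ]
  [DecidableEq ι] [DecidableEq κ] [DecidableEq μ]

/-- A square complex matrix shifted off its spectrum is invertible: `z ∉ σ(A) ⟹ A - z•1 ∈ GL`.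
[folklore] -/
theorem isUnit_sub_smul_one_of_not_mem_spectrum {A : Matrix ι ι ℂ} {z : ℂ}
    (hz : z ∉ spectrum ℂ A) : IsUnit (A - z • (1 : Matrix ι ι ℂ)) := by
  have h : IsUnit (algebraMap ℂ (Matrix ι ι ℂ) z - A) := by
    by_contra hu
    exact hz (spectrum.mem_iff.mpr hu)
  rw [Algebra.algebraMap_eq_smul_one] at h
  rw [← neg_sub]
  exact h.neg

/-- The one-parameter family `z ↦ ((A - z•1) ⊗ (B - z•1) ⊗ (C - z•1))·s` is continuous (its entries are
polynomials in `z`). [folklore] -/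
theorem continuous_actTensor_shift (A : Matrix ι ι ℂ) (B : Matrix κ κ ℂ) (C : Matrix μ μ ℂ)
    (s : ι → κ → μ → ℂ) :
    Continuous fun z : ℂ =>
      actTensor (A - z • (1 : Matrix ι ι ℂ)) (B - z • (1 : Matrix κ κ ℂ))
        (C - z • (1 : Matrix μ μ ℂ)) s := by
  refine continuous_pi_iff.2 fun a => continuous_pi_iff.2 fun b => continuous_pi_iff.2 fun c => ?_
  simp only [actTensor_apply, Matrix.sub_apply, Matrix.smul_apply, smul_eq_mul]
  fun_prop

/-- **Restriction implies degeneration** for tensors of the same format: if `t = (A ⊗ B ⊗ C)·s` for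
square (possibly singular) `A, B, C`, then `t ∈ cl(GL³·s)`.  Proof: the spectra of `A, B, C` are finite
(`Matrix.finite_spectrum`), so `(A - z•1, B - z•1, C - z•1) ∈ GL³` for all `z ≠ 0` near `0`, and
`((A - z•1) ⊗ (B - z•1) ⊗ (C - z•1))·s → t` as `z → 0`. [cite: ChristandlVranaZuiddam2023, Rem. 1.2]
[cite: BurgisserIkenmeyer2017, §4.2] -/
theorem tensorDegeneratesTo_of_restrictsTo {s t : ι → κ → μ → ℂ} (h : TensorRestrictsTo s t) :
    TensorDegeneratesTo s t := by
  obtain ⟨A, B, C, rfl⟩ := (tensorRestrictsTo_iff_exists_actTensor s t).1 h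
  set f : ℂ → (ι → κ → μ → ℂ) := fun z =>
    actTensor (A - z • (1 : Matrix ι ι ℂ)) (B - z • (1 : Matrix κ κ ℂ))
      (C - z • (1 : Matrix μ μ ℂ)) s with hf_def
  have hf : Continuous f := continuous_actTensor_shift A B C s
  have hf0 : f 0 = actTensor A B C s := by simp [hf_def]
  set Bad : Set ℂ := spectrum ℂ A ∪ spectrum ℂ B ∪ spectrum ℂ C with hBad
  have hBadfin : Bad.Finite :=
    ((Matrix.finite_spectrum A).union (Matrix.finite_spectrum B)).union (Matrix.finite_spectrum C)
  have hev : ∀ᶠ z in 𝓝[≠] (0 : ℂ), z ∉ Bad := by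
    rw [eventually_nhdsWithin_iff]
    have hopen : (Bad \ {0})ᶜ ∈ 𝓝 (0 : ℂ) :=
      (hBadfin.sdiff).isClosed.isOpen_compl.mem_nhds (by simp)
    filter_upwards [hopen] with z hz hz0 hzB
    exact hz (Set.mem_sdiff_of_mem hzB hz0)
  have hmem : ∀ᶠ z in 𝓝[≠] (0 : ℂ), f z ∈ Set.range (fun g : GL ι ℂ × GL κ ℂ × GL μ ℂ =>
      actTensor (g.1 : Matrix ι ι ℂ) (g.2.1 : Matrix κ κ ℂ) (g.2.2 : Matrix μ μ ℂ) s) := by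
    filter_upwards [hev] with z hz
    simp only [hBad, Set.mem_union, not_or] at hz
    obtain ⟨⟨hzA, hzB⟩, hzC⟩ := hz
    have uA := isUnit_sub_smul_one_of_not_mem_spectrum hzA
    have uB := isUnit_sub_smul_one_of_not_mem_spectrum hzB
    have uC := isUnit_sub_smul_one_of_not_mem_spectrum hzC
    exact ⟨(uA.unit, uB.unit, uC.unit), by simp [hf_def, IsUnit.unit_spec]⟩
  haveI : NeBot (𝓝[≠] (0 : ℂ)) := NormedField.nhdsNE_neBot 0
  have hlim : Tendsto f (𝓝[≠] (0 : ℂ)) (𝓝 (actTensor A B C s)) := by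
    rw [← hf0]
    exact (hf.tendsto 0).mono_left nhdsWithin_le_nhds
  exact mem_closure_of_tendsto hlim hmem

/-- Restriction and degeneration to a tensor of the same format: `s ≥ t ⟹ s ⊵ t`, contrapositive form.
[folklore] -/
theorem not_restrictsTo_of_not_degeneratesTo {s t : ι → κ → μ → ℂ} (h : ¬ TensorDegeneratesTo s t) :
    ¬ TensorRestrictsTo s t :=
  fun hr => h (tensorDegeneratesTo_of_restrictsTo hr)

end General

/-! ## §2  Relabelling the target of a restriction -/

section Relabel

/-- A restriction to `t` is a restriction to every relabelling `e^* t` of `t` (compose the three maps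
with `e`). [folklore] -/
theorem tensorRestrictsTo_relabel {κ₁ κ₂ κ₃ ι ι' : Type*} [Fintype κ₁] [Fintype κ₂] [Fintype κ₃]
    [Fintype ι] [Fintype ι'] {s : κ₁ → κ₂ → κ₃ → ℂ} {t : ι → ι → ι → ℂ} (e : ι' ≃ ι)
    (h : TensorRestrictsTo s t) : TensorRestrictsTo s (fun a b c => t (e a) (e b) (e c)) := by
  obtain ⟨A, B, C, h⟩ := h
  exact ⟨fun x a => A (e x) a, fun y b => B (e y) b, fun z c => C (e z) c,
    fun x y z => h (e x) (e y) (e z)⟩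

end Relabel

/-! ## §3  The minrank gap for restrictions: no rung `p/q`, `p < q`, restricts at any finite level -/

section MinrankGap

open OutsiderSandwichMinrankGap

/-- For `m < 2^N` and every bijection `e` of the formats, `⟨n⟩ ⊠ cw₂^{⊠N}` does not RESTRICT to
`e^*(⟨n'⟩ ⊠ ⟨m,m,m⟩)` (restriction ⟹ degeneration, and the minrank gap
`unitKronecker_cwTwoPow_not_degeneratesTo_matMul`). [cite: BlaserIkenmeyerLysikovPandeySchreyer2019, Lemma 18]
[cite: KempfNess1979, Thm. 0.2] -/
theorem unitKronecker_cwTwoPow_not_restrictsTo_relabel_matMul {n N n' m : ℕ} (hn' : 0 < n')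
    (hm : 0 < m) (hmN : m < 2 ^ N) (e : (Fin n × (Fin N → Fin 3)) ≃ (Fin n' × (Fin m × Fin m))) :
    ¬ TensorRestrictsTo (kroneckerTensor (unitTensor ℂ n) (kroneckerPow (cwTensor ℂ 2) N))
      (fun a b c => kroneckerTensor (unitTensor ℂ n') (matMulTensor ℂ m m m) (e a) (e b) (e c)) :=
  not_restrictsTo_of_not_degeneratesTo (unitKronecker_cwTwoPow_not_degeneratesTo_matMul hn' hm hmN e)

/-- **No finite-level restriction in equal format.**  If `n·3^N = n'·m²` (equal formats) and `m < 2^N`,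
then `⟨n⟩ ⊠ cw₂^{⊠N} ≱ ⟨n'⟩ ⊠ ⟨m,m,m⟩` — no relabelling in the statement: a restriction to the target is a
restriction to any relabelled copy (`tensorRestrictsTo_relabel`), and a bijection of the index sets exists by
cardinality. [cite: BlaserIkenmeyerLysikovPandeySchreyer2019, Lemma 18] [cite: KempfNess1979, Thm. 0.2] -/
theorem unitKronecker_cwTwoPow_not_restrictsTo_matMul {n N n' m : ℕ} (hn' : 0 < n') (hm : 0 < m)
    (hmN : m < 2 ^ N) (hfmt : n * 3 ^ N = n' * (m * m)) :
    ¬ TensorRestrictsTo (kroneckerTensor (unitTensor ℂ n) (kroneckerPow (cwTensor ℂ 2) N))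
      (kroneckerTensor (unitTensor ℂ n') (matMulTensor ℂ m m m)) := by
  intro h
  have hcard : Fintype.card (Fin n × (Fin N → Fin 3)) = Fintype.card (Fin n' × (Fin m × Fin m)) := by
    simp only [Fintype.card_prod, Fintype.card_fun, Fintype.card_fin]
    exact hfmt
  exact unitKronecker_cwTwoPow_not_restrictsTo_relabel_matMul hn' hm hmN (Fintype.equivOfCardEq hcard)
    (tensorRestrictsTo_relabel (Fintype.equivOfCardEq hcard) h)

/-- **No exchange rung `p/q` with `p < q` restricts at any finite level**: for every `L ≥ 1`,
`⟨4^{pL}⟩ ⊠ cw₂^{⊠ qL} ≱ ⟨3^{qL}⟩ ⊠ ⟨2^{pL}, 2^{pL}, 2^{pL}⟩` (both of format `3^{qL}·4^{pL}`; `m = 2^{pL} <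
2^{qL}`).  The rungs of the g31/g32 ladder are intrinsically ASYMPTOTIC statements: the `2^{o(L)}` slack of
`≲` cannot be removed at any level. [cite: Strassen1988, Thm. 3.8] [cite: KempfNess1979, Thm. 0.2] -/
theorem rung_not_restrictsTo_of_lt {p q L : ℕ} (hpq : p < q) (hL : 0 < L) :
    ¬ TensorRestrictsTo
        (kroneckerTensor (unitTensor ℂ (4 ^ (p * L))) (kroneckerPow (cwTensor ℂ 2) (q * L)))
        (kroneckerTensor (unitTensor ℂ (3 ^ (q * L)))
          (matMulTensor ℂ (2 ^ (p * L)) (2 ^ (p * L)) (2 ^ (p * L)))) := by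
  refine unitKronecker_cwTwoPow_not_restrictsTo_matMul (by positivity) (by positivity)
    (Nat.pow_lt_pow_right (by norm_num) (Nat.mul_lt_mul_of_pos_right hpq hL)) ?_
  rw [← pow_add, show (4 : ℕ) = 2 ^ 2 by norm_num, ← pow_mul, mul_comm (3 ^ (q * L))]
  congr 1
  ring_nf

/-- **The first open rung `1/2` does not restrict at level one**: `⟨4⟩ ⊠ cw₂^{⊠2} ≱ ⟨9⟩ ⊠ ⟨2,2,2⟩`
(both of format `36`; critic g15 remark r3 / NODE-g32 §3, now a theorem with no relabelling and no
enumeration). [cite: KempfNess1979, Thm. 0.2] [cite: BlaserIkenmeyerLysikovPandeySchreyer2019, Lemma 18] -/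
theorem rungHalf_not_restrictsTo_levelOne :
    ¬ TensorRestrictsTo (kroneckerTensor (unitTensor ℂ 4) (kroneckerPow (cwTensor ℂ 2) 2))
      (kroneckerTensor (unitTensor ℂ 9) (matMulTensor ℂ 2 2 2)) :=
  unitKronecker_cwTwoPow_not_restrictsTo_matMul (by norm_num) (by norm_num) (by norm_num) (by norm_num)

/-- Rung `1/2` does not restrict at level two: `⟨16⟩ ⊠ cw₂^{⊠4} ≱ ⟨81⟩ ⊠ ⟨4,4,4⟩` (format `1296`).
[cite: KempfNess1979, Thm. 0.2] -/
theorem rungHalf_not_restrictsTo_levelTwo :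
    ¬ TensorRestrictsTo (kroneckerTensor (unitTensor ℂ 16) (kroneckerPow (cwTensor ℂ 2) 4))
      (kroneckerTensor (unitTensor ℂ 81) (matMulTensor ℂ 4 4 4)) :=
  unitKronecker_cwTwoPow_not_restrictsTo_matMul (by norm_num) (by norm_num) (by norm_num) (by norm_num)

/-- Rung `1/3` does not restrict at level one: `⟨4⟩ ⊠ cw₂^{⊠3} ≱ ⟨27⟩ ⊠ ⟨2,2,2⟩` (format `108`).
[cite: KempfNess1979, Thm. 0.2] -/
theorem rungThird_not_restrictsTo_levelOne :
    ¬ TensorRestrictsTo (kroneckerTensor (unitTensor ℂ 4) (kroneckerPow (cwTensor ℂ 2) 3))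
      (kroneckerTensor (unitTensor ℂ 27) (matMulTensor ℂ 2 2 2)) :=
  unitKronecker_cwTwoPow_not_restrictsTo_matMul (by norm_num) (by norm_num) (by norm_num) (by norm_num)

/-- Rung `2/3` does not restrict at level one: `⟨16⟩ ⊠ cw₂^{⊠3} ≱ ⟨27⟩ ⊠ ⟨4,4,4⟩` (format `432`).
[cite: KempfNess1979, Thm. 0.2] -/
theorem rungTwoThirds_not_restrictsTo_levelOne :
    ¬ TensorRestrictsTo (kroneckerTensor (unitTensor ℂ 16) (kroneckerPow (cwTensor ℂ 2) 3))
      (kroneckerTensor (unitTensor ℂ 27) (matMulTensor ℂ 4 4 4)) :=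
  unitKronecker_cwTwoPow_not_restrictsTo_matMul (by norm_num) (by norm_num) (by norm_num) (by norm_num)

/-- The unit-packed perfection cells as non-restrictions: `⟨1⟩ ⊠ cw₂^{⊠N} ≱ ⟨1⟩ ⊠ ⟨m,m,m⟩` whenever
`m² = 3^N`, `N ≥ 1` (then `m = 3^{N/2} < 2^N`); cf. `CwTwoNoExactPerfection` (which proves more: `m² < 3^N` for
restrictions of any format) — recorded here as the `n = n' = 1` instance of the gap. [cite: KempfNess1979, Thm. 0.2] -/
theorem cell_not_restrictsTo_of_sq_eq {N m : ℕ} (h : m * m = 3 ^ N) (hN : 1 ≤ N) :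
    ¬ TensorRestrictsTo (kroneckerTensor (unitTensor ℂ 1) (kroneckerPow (cwTensor ℂ 2) N))
      (kroneckerTensor (unitTensor ℂ 1) (matMulTensor ℂ m m m)) := by
  intro hr
  have hcard : Fintype.card (Fin 1 × (Fin N → Fin 3)) = Fintype.card (Fin 1 × (Fin m × Fin m)) := by
    simp only [Fintype.card_prod, Fintype.card_fun, Fintype.card_fin]
    omega
  exact cell_not_degeneratesTo_of_sq_eq h hN (Fintype.equivOfCardEq hcard)
    (tensorDegeneratesTo_of_restrictsTo (tensorRestrictsTo_relabel (Fintype.equivOfCardEq hcard) hr))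

end MinrankGap

end Summit.MatrixMultiplication.MatrixMultiplication.Theorems.OutsiderSandwichRestrictionGap

end
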